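import Summits.Ventures.HodgeRepro2.T5SU11JacobiWeightDeriv2

/-!
# The first two moments of the phase `log|a(g)|` under `(1 − |g·0|²)^{k/2} dν`: exponential-law values

At `λ = 0` (`φ_0 ≡ 1`) the transform is `∫_G (1 − |g·0|²)^{k/2} dν = 2π/(k − 2)` (`k > 2`,
`T5SU11JacobiTransform.integral_orbit_rpow_mul_sph_zero`), and the derivative formulas of
`T5SU11JacobiWeightDeriv` / `T5SU11JacobiWeightDeriv2` identify the moments of the phase
`s(g) = log|a(g)|` by differentiating `2π/(k − 2)`:

  **`∫_G log|a(g)| (1 − |g·0|²)^{k/2} dν = 2π/(k − 2)²`,   `∫_G (log|a(g)|)² (1 − |g·0|²)^{k/2} dν = 4π/(k − 2)³`**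

(`integral_log_norm_mat_mul_orbit_rpow`, `integral_sq_log_norm_mat_mul_orbit_rpow`), i.e. for the
probability measure `(k − 2)/(2π) · m_k dν` the phase has **mean `1/(k − 2)`, second moment `2/(k − 2)²`
and variance `1/(k − 2)²`** (`mean_phase`, `second_moment_phase`, `variance_phase`) — the moments of an
exponential law of rate `k − 2`, as the Cartan-coordinate density `e^{2s} ds` of the phase predicts.
The same values hold at `λ = 2` (`φ_2 ≡ 1`). Nothing is claimed about (N).

Blind lane: Mathlib + the HodgeRepro2 prefix only; no sorry; axioms ⊆ {propext, Classical.choice,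
Quot.sound}.
-/

namespace Summit.Ventures.HodgeRepro2.T5SU11JacobiPhaseMoments

open MeasureTheory MeasureTheory.Measure Metric Set Filter Topology
open T5SU11Unimodular T5SU11Fibration T5SU11Cartan T5HaarCircle T5BergmanCoefficient
  T5SU11FibrationHaar T5SU11SphericalFunction T5SU11SphericalSymmetry T5SU11SphericalBounds
  T5SU11JacobiIwasawa T5SU11JacobiTransform T5SU11KFiniteMajorantPow T5SU11JacobiWeight
  T5SU11JacobiWeightDeriv T5SU11JacobiWeightDeriv2
open scoped Real

/-- `k ↦ 2π/(k − 2)` has derivative `−2π/(k − 2)²` for `k ≠ 2`. -/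
lemma hasDerivAt_two_pi_div {k : ℝ} (hk : k - 2 ≠ 0) :
    HasDerivAt (fun k : ℝ => 2 * π / (k - 2)) (-(2 * π) / (k - 2) ^ 2) k := by
  have h : HasDerivAt (fun k : ℝ => k - 2) 1 k := (hasDerivAt_id k).sub_const 2
  have := (hasDerivAt_const k (2 * π)).div h hk
  refine this.congr_deriv ?_
  field_simp
  ring

/-- `k ↦ −2π/(k − 2)²` has derivative `4π/(k − 2)³` for `k ≠ 2`. -/
lemma hasDerivAt_neg_two_pi_div_sq {k : ℝ} (hk : k - 2 ≠ 0) :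
    HasDerivAt (fun k : ℝ => -(2 * π) / (k - 2) ^ 2) (4 * π / (k - 2) ^ 3) k := by
  have h : HasDerivAt (fun k : ℝ => (k - 2) ^ 2) (2 * (k - 2)) k := by
    have := ((hasDerivAt_id k).sub_const 2).pow 2
    refine this.congr_deriv ?_
    simp
  have := (hasDerivAt_const k (-(2 * π))).div h (pow_ne_zero 2 hk)
  refine this.congr_deriv ?_
  field_simp
  ring

section measure

variable [MeasurableSpace Circle] [BorelSpace Circle]

/-- On `k > 2` the transform at `λ = 0` is `2π/(k − 2)`, as functions near `k`. -/
lemma jacobi_zero_eventuallyEq {k : ℝ} (hk : 2 < k) :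
    (fun k => ∫ g, (1 - ‖orbit g‖ ^ 2) ^ (k / 2) * sph 0 g ∂(nu haarCircle))
      =ᶠ[𝓝 k] fun k => 2 * π / (k - 2) := by
  filter_upwards [Ioi_mem_nhds hk] with k' hk'
  exact integral_orbit_rpow_mul_sph_zero (mem_Ioi.mp hk')

/-- **The first moment of the phase**: `∫_G log|a(g)| (1 − |g·0|²)^{k/2} dν = 2π/(k − 2)²` for `k > 2`. -/
theorem integral_log_norm_mat_mul_orbit_rpow {k : ℝ} (hk : 2 < k) :
    ∫ g, Real.log ‖mat g 0 0‖ * (1 - ‖orbit g‖ ^ 2) ^ (k / 2) ∂(nu haarCircle) = 2 * π / (k - 2) ^ 2 := by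
  have hk2 : k - 2 ≠ 0 := by
    intro h
    linarith
  have h1 := hasDerivAt_jacobi_weight (lam := 0) (by linarith) (by linarith) (by linarith)
  have h2 := (hasDerivAt_two_pi_div hk2).congr_of_eventuallyEq (jacobi_zero_eventuallyEq hk)
  have h := h1.unique h2
  simp only [sph_zero, mul_one] at h
  rw [neg_div] at h
  linarith

/-- The same at `λ = 2` (`φ_2 ≡ 1`), in the transform's own notation. -/
theorem integral_log_norm_mat_mul_orbit_rpow_mul_sph_zero {k : ℝ} (hk : 2 < k) :
    ∫ g, Real.log ‖mat g 0 0‖ * ((1 - ‖orbit g‖ ^ 2) ^ (k / 2) * sph 0 g) ∂(nu haarCircle)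
      = 2 * π / (k - 2) ^ 2 := by
  simp_rw [sph_zero, mul_one]
  exact integral_log_norm_mat_mul_orbit_rpow hk

/-- **The second moment of the phase**: `∫_G (log|a(g)|)² (1 − |g·0|²)^{k/2} dν = 4π/(k − 2)³` for `k > 2`. -/
theorem integral_sq_log_norm_mat_mul_orbit_rpow {k : ℝ} (hk : 2 < k) :
    ∫ g, Real.log ‖mat g 0 0‖ ^ 2 * (1 - ‖orbit g‖ ^ 2) ^ (k / 2) ∂(nu haarCircle)
      = 4 * π / (k - 2) ^ 3 := by
  have hk2 : k - 2 ≠ 0 := by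
    intro h
    linarith
  -- the derivative of the transform is `−2π/(k−2)²` near `k`, so its derivative is `4π/(k−2)³`
  have hd : (deriv fun k => ∫ g, (1 - ‖orbit g‖ ^ 2) ^ (k / 2) * sph 0 g ∂(nu haarCircle))
      =ᶠ[𝓝 k] fun k => -(2 * π) / (k - 2) ^ 2 := by
    filter_upwards [Ioi_mem_nhds hk] with k' hk'
    rw [mem_Ioi] at hk'
    have hk2' : k' - 2 ≠ 0 := by
      intro h
      linarith
    exact ((hasDerivAt_two_pi_div hk2').congr_of_eventuallyEq
      (jacobi_zero_eventuallyEq hk')).deriv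
  have h1 := hasDerivAt_deriv_jacobi_weight (lam := 0) (by linarith) (by linarith) (by linarith)
  have h2 := (hasDerivAt_neg_two_pi_div_sq hk2).congr_of_eventuallyEq hd
  have h := h1.unique h2
  simp only [sph_zero, mul_one] at h
  exact h

/-! ### The normalised moments -/

/-- **The mean phase is `1/(k − 2)`**: `⟨log|a|⟩_{k,0} = (∫ s m_k dν)/(∫ m_k dν) = 1/(k − 2)`. -/
theorem mean_phase {k : ℝ} (hk : 2 < k) :
    (∫ g, Real.log ‖mat g 0 0‖ * (1 - ‖orbit g‖ ^ 2) ^ (k / 2) ∂(nu haarCircle))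
        / ∫ g, (1 - ‖orbit g‖ ^ 2) ^ (k / 2) ∂(nu haarCircle) = 1 / (k - 2) := by
  rw [integral_log_norm_mat_mul_orbit_rpow hk, integral_orbit_rpow_nu hk]
  have hk2 : k - 2 ≠ 0 := by
    intro h
    linarith
  field_simp

/-- **The second moment is `2/(k − 2)²`.** -/
theorem second_moment_phase {k : ℝ} (hk : 2 < k) :
    (∫ g, Real.log ‖mat g 0 0‖ ^ 2 * (1 - ‖orbit g‖ ^ 2) ^ (k / 2) ∂(nu haarCircle))
        / ∫ g, (1 - ‖orbit g‖ ^ 2) ^ (k / 2) ∂(nu haarCircle) = 2 / (k - 2) ^ 2 := by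
  rw [integral_sq_log_norm_mat_mul_orbit_rpow hk, integral_orbit_rpow_nu hk]
  have hk2 : k - 2 ≠ 0 := by
    intro h
    linarith
  field_simp
  ring

/-- **The variance of the phase is `1/(k − 2)²`**: `⟨s²⟩ − ⟨s⟩² = 2/(k−2)² − 1/(k−2)²`. -/
theorem variance_phase {k : ℝ} (hk : 2 < k) :
    (∫ g, Real.log ‖mat g 0 0‖ ^ 2 * (1 - ‖orbit g‖ ^ 2) ^ (k / 2) ∂(nu haarCircle))
        / (∫ g, (1 - ‖orbit g‖ ^ 2) ^ (k / 2) ∂(nu haarCircle))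
      - ((∫ g, Real.log ‖mat g 0 0‖ * (1 - ‖orbit g‖ ^ 2) ^ (k / 2) ∂(nu haarCircle))
        / ∫ g, (1 - ‖orbit g‖ ^ 2) ^ (k / 2) ∂(nu haarCircle)) ^ 2 = 1 / (k - 2) ^ 2 := by
  rw [second_moment_phase hk, mean_phase hk]
  have hk2 : k - 2 ≠ 0 := by
    intro h
    linarith
  field_simp
  ring

/-- The second derivative of `log m̂_k(0)` is the variance `1/(k − 2)²` (`T5SU11JacobiWeightDeriv2`
read at `λ = 0`; a consistency check: `log(2π/(k − 2))'' = 1/(k − 2)²`). -/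
theorem deriv2_log_jacobi_zero {k : ℝ} (hk : 2 < k) :
    deriv (deriv fun k => Real.log (∫ g, (1 - ‖orbit g‖ ^ 2) ^ (k / 2) * sph 0 g ∂(nu haarCircle))) k
      = 1 / (k - 2) ^ 2 := by
  rw [deriv2_log_jacobi_weight (by linarith) (by linarith) (by linarith)]
  simp only [sph_zero, mul_one]
  exact variance_phase hk

end measure

end Summit.Ventures.HodgeRepro2.T5SU11JacobiPhaseMoments
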